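import Mathlib
import HarnessLib
import Summits.KontsevichZagierPeriods.Zeta5Search.DougallSeriesSide
import Summits.KontsevichZagierPeriods.Zeta5Search.DougallGammaSideBound
import Summits.KontsevichZagierPeriods.Zeta5Search.DougallCoefficientBounds
import Literature.Analysis.Complex.CarlsonTheorem

/-!
# ζ(5) search — Dougall's NON-terminating `₅F₄` sum (real parameters, Carlson range) (cell `pub-zeta5`, ct-1 g26)

HONEST FRAMING: systematic search; no irrationality claim unless kernel-certified.  An identity of special functions
(a non-terminating very-well-poised summation); nothing here is an irrationality result; no named fact of the tree is
discharged by it.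

Brick B5f of `HOME/ct-1/g26/VWP-BLUEPRINT.md`: the ASSEMBLY of B5a–B5e by Carlson's theorem (bounded form,
`Literature.Analysis.Complex.AndrewsAskeyRoy1999_thm_2_8_1_holds`) and the identity theorem.  For REAL `h₀, h₁, h₂ > 0` with
`2(h₁+h₂) < 1+h₀` and every complex `z` with `Re z > −(1+h₀)/2`:

`Σ_μ (h₀+2μ)·Γ(h₀+μ)Γ(h₁+μ)Γ(h₂+μ)/(Γ(μ+1)Γ(h₀−h₁+1+μ)Γ(h₀−h₂+1+μ)) · (−z)_μ/(h₀+1+z)_μ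
   = Γ(h₁)Γ(h₂)Γ(h₀+1+z)Γ(h₀−h₁−h₂+1+z)/(Γ(h₀−h₁−h₂+1)Γ(h₀−h₁+1+z)Γ(h₀−h₂+1+z))`            (`dougall_nonterminating`)

— Dougall's `₅F₄` summation [cite: Bailey1935, §4.4 (1)] [cite: AndrewsAskeyRoy1999, Cor. 3.5.2] with the last parameter
pair `e = −z`, `1+h₀−e` in Pochhammer normalisation, i.e. Zudilin's (9) [math/0206177, Lemma 1] at `h₃ = −z` up to the factor
`Γ(h₃)/Γ(1+h₀−h₃)`; at real `z = −h₃`, `0 < h₃ < (1+h₀)/2`, it is the case `k = 1` of `vwp_eq_integral_of_pos`'s hypergeometric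
side in the Carlson range.  Route: both sides are holomorphic on `U = {Re z > −(1+h₀)/2}` (`DougallSeriesSide.differentiableOn_series`
with `DougallCoefficientBounds.summable_norm_dougallCoeff_complex`; `DougallCarlsonSides.differentiableOn_gamma_side`), agree at
`z ∈ ℕ` (`DougallCarlsonSides.series_side_nat`), and `(S − G)/(z+1+h₀)^{⌊h₂⌋₊+1}` is bounded on `{Re z ≥ 0}`
(`DougallSeriesSide.norm_series_le`, `DougallGammaSideBound.gamma_side_polynomial_bound`, `|z+1+h₀| ≥ (|z|+1+h₀)/2`); Carlson
gives `S = G` on `{Re z ≥ 0}`, the identity theorem on the convex `U` gives the rest.  Theorems only (no new definitions).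
-/

noncomputable section

namespace Summit.KontsevichZagierPeriods.Zeta5Search.DougallNonterminating

open Filter Set
open scoped Topology
open Summit.KontsevichZagierPeriods.Zeta5Search.HypergeometricWhipple (rf)
open Summit.KontsevichZagierPeriods.Zeta5Search.DougallCarlsonSides (series_side_nat differentiableOn_gamma_side)
open Summit.KontsevichZagierPeriods.Zeta5Search.DougallSeriesSide (differentiableOn_series norm_series_le)
open Summit.KontsevichZagierPeriods.Zeta5Search.DougallGammaSideBound (gamma_side_polynomial_bound)
open Summit.KontsevichZagierPeriods.Zeta5Search.DougallCoefficientBounds (summable_norm_dougallCoeff_complex)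

/-- On `{Re z ≥ 0}`, for real `A > 0`: `‖z + A‖ ≥ (‖z‖ + A)/2`. -/
theorem norm_add_pos_ge {A : ℝ} (hA : 0 < A) {z : ℂ} (hz : 0 ≤ z.re) : (‖z‖ + A) / 2 ≤ ‖z + A‖ := by
  have h1 : ‖z‖ ≤ ‖z + A‖ := by
    rw [Complex.norm_def, Complex.norm_def]
    refine Real.sqrt_le_sqrt ?_
    rw [Complex.normSq_apply, Complex.normSq_apply]
    simp only [Complex.add_re, Complex.ofReal_re, Complex.add_im, Complex.ofReal_im]
    nlinarith
  have h2 : A ≤ ‖z + A‖ := by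
    calc A ≤ (z + A).re := by simp; linarith
      _ ≤ ‖z + A‖ := Complex.re_le_norm _
  linarith

/-- **Dougall's non-terminating `₅F₄` summation, real parameters, on the Carlson half-plane.**  For real
`h₀, h₁, h₂ > 0` with `2(h₁+h₂) < 1+h₀` and `Re z > −(1+h₀)/2`:
`Σ_μ (h₀+2μ)Γ(h₀+μ)Γ(h₁+μ)Γ(h₂+μ)/(Γ(μ+1)Γ(h₀−h₁+1+μ)Γ(h₀−h₂+1+μ))·(−z)_μ/(h₀+1+z)_μ
 = Γ(h₁)Γ(h₂)Γ(h₀+1+z)Γ(h₀−h₁−h₂+1+z)/(Γ(h₀−h₁−h₂+1)Γ(h₀−h₁+1+z)Γ(h₀−h₂+1+z))`.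
[cite: Bailey1935, §4.4 (1)] [cite: AndrewsAskeyRoy1999, §3.5, Cor. 3.5.2] -/
theorem dougall_nonterminating (h₀ h₁ h₂ : ℝ) (hh₀ : 0 < h₀) (hh₁ : 0 < h₁) (hh₂ : 0 < h₂)
    (hsum : 2 * (h₁ + h₂) < 1 + h₀) {z : ℂ} (hz : -(1 + h₀) / 2 < z.re) :
    ∑' μ : ℕ, ((h₀ : ℂ) + 2 * μ) *
        (Complex.Gamma ((h₀ : ℂ) + μ) * Complex.Gamma ((h₁ : ℂ) + μ) * Complex.Gamma ((h₂ : ℂ) + μ)) /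
          (Complex.Gamma ((μ : ℂ) + 1) * Complex.Gamma ((h₀ : ℂ) - h₁ + 1 + μ) * Complex.Gamma ((h₀ : ℂ) - h₂ + 1 + μ)) *
        (rf (-z) μ / rf ((h₀ : ℂ) + 1 + z) μ) =
      Complex.Gamma h₁ * Complex.Gamma h₂ * Complex.Gamma ((h₀ : ℂ) + 1 + z) *
        Complex.Gamma ((h₀ : ℂ) - h₁ - h₂ + 1 + z) /
        (Complex.Gamma ((h₀ : ℂ) - h₁ - h₂ + 1) * Complex.Gamma ((h₀ : ℂ) - h₁ + 1 + z) *
          Complex.Gamma ((h₀ : ℂ) - h₂ + 1 + z)) := by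
  -- the two sides as functions
  set c : ℕ → ℂ := fun μ => ((h₀ : ℂ) + 2 * μ) *
        (Complex.Gamma ((h₀ : ℂ) + μ) * Complex.Gamma ((h₁ : ℂ) + μ) * Complex.Gamma ((h₂ : ℂ) + μ)) /
          (Complex.Gamma ((μ : ℂ) + 1) * Complex.Gamma ((h₀ : ℂ) - h₁ + 1 + μ) * Complex.Gamma ((h₀ : ℂ) - h₂ + 1 + μ))
    with hc
  set S : ℂ → ℂ := fun w => ∑' μ : ℕ, c μ * (rf (-w) μ / rf ((h₀ : ℂ) + 1 + w) μ) with hS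
  set G : ℂ → ℂ := fun w => Complex.Gamma h₁ * Complex.Gamma h₂ * Complex.Gamma ((h₀ : ℂ) + 1 + w) *
        Complex.Gamma ((h₀ : ℂ) - h₁ - h₂ + 1 + w) /
        (Complex.Gamma ((h₀ : ℂ) - h₁ - h₂ + 1) * Complex.Gamma ((h₀ : ℂ) - h₁ + 1 + w) *
          Complex.Gamma ((h₀ : ℂ) - h₂ + 1 + w)) with hG
  change S z = G z
  set U : Set ℂ := {w : ℂ | -(1 + h₀) / 2 < w.re} with hU
  have hUo : IsOpen U := isOpen_lt continuous_const Complex.continuous_re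
  have hh : (-1 : ℝ) < h₀ := by linarith
  have hcs := summable_norm_dougallCoeff_complex h₀ h₁ h₂ hh₀ hh₁ hh₂ hsum
  -- holomorphy on `U`
  have hSU : DifferentiableOn ℂ S U := differentiableOn_series hh (c := c) hcs
  have hGU : DifferentiableOn ℂ G U :=
    differentiableOn_gamma_side (h₀ : ℂ) (h₁ : ℂ) (h₂ : ℂ) (c := -(1 + h₀) / 2) (by simp; linarith) (by simp; linarith)
  -- agreement at the naturals
  have hnat : ∀ n : ℕ, S n = G n := by
    intro n
    have key := series_side_nat (h₀ : ℂ) h₁ h₂ n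
      (fun m h => by have := congrArg Complex.re h; simp at this; linarith [m.cast_nonneg (α := ℝ)])
      (fun m h => by have := congrArg Complex.re h; simp at this; linarith [m.cast_nonneg (α := ℝ)])
      (fun m h => by have := congrArg Complex.re h; simp at this; linarith [m.cast_nonneg (α := ℝ)])
      (fun m h => by have := congrArg Complex.re h; simp at this; linarith [m.cast_nonneg (α := ℝ)])
      (fun m h => by have := congrArg Complex.re h; simp at this; linarith [m.cast_nonneg (α := ℝ)])
      (fun m h => by have := congrArg Complex.re h; simp at this; linarith [m.cast_nonneg (α := ℝ)])
      (fun m h => by have := congrArg Complex.re h; simp at this; linarith [m.cast_nonneg (α := ℝ)])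
    rw [show ((h₀ : ℂ) + n + 1) = (h₀ : ℂ) + 1 + n by ring] at key
    simpa [hS, hG, hc] using key
  -- the bounds on `{Re z ≥ 0}`
  obtain ⟨C, hC⟩ := gamma_side_polynomial_bound h₀ h₁ h₂ hh₁ hh₂ (by linarith)
  set N : ℕ := ⌊h₂⌋₊ + 1 with hN
  have hA0 : 0 < 1 + h₀ := by linarith
  set M : ℝ := ∑' μ : ℕ, ‖c μ‖ with hM
  have hS_le : ∀ w : ℂ, 0 ≤ w.re → ‖S w‖ ≤ M := fun w hw =>
    norm_series_le hh hcs (by linarith)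
  have hG_le : ∀ w : ℂ, 0 ≤ w.re → ‖G w‖ ≤
      ‖Complex.Gamma (h₁ : ℂ) * Complex.Gamma (h₂ : ℂ) / Complex.Gamma ((h₀ : ℂ) - h₁ - h₂ + 1)‖ * (C * (1 + ‖w‖) ^ N) := by
    intro w hw
    have h := hC w hw
    have e : G w = (Complex.Gamma (h₁ : ℂ) * Complex.Gamma (h₂ : ℂ) / Complex.Gamma ((h₀ : ℂ) - h₁ - h₂ + 1)) *
        (Complex.Gamma (1 + h₀ + w) * Complex.Gamma (1 + h₀ - h₁ - h₂ + w) /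
          (Complex.Gamma (1 + h₀ - h₁ + w) * Complex.Gamma (1 + h₀ - h₂ + w))) := by
      rw [hG]
      simp only []
      rw [show (h₀ : ℂ) + 1 + w = 1 + h₀ + w by ring, show (h₀ : ℂ) - h₁ - h₂ + 1 + w = 1 + h₀ - h₁ - h₂ + w by ring,
        show (h₀ : ℂ) - h₁ + 1 + w = 1 + h₀ - h₁ + w by ring, show (h₀ : ℂ) - h₂ + 1 + w = 1 + h₀ - h₂ + w by ring]
      ring
    rw [e, norm_mul]
    exact mul_le_mul_of_nonneg_left h (norm_nonneg _)
  -- the Carlson function `g = (S − G)/(w + A)^N`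
  set g : ℂ → ℂ := fun w => (S w - G w) / (w + ((1 + h₀ : ℝ) : ℂ)) ^ N with hg
  have hne : ∀ w ∈ U, (w : ℂ) + ((1 + h₀ : ℝ) : ℂ) ≠ 0 := by
    intro w hw h
    have := congrArg Complex.re h
    simp only [Complex.add_re, Complex.ofReal_re, Complex.zero_re] at this
    have hw' : -(1 + h₀) / 2 < w.re := hw
    linarith
  have hgU : DifferentiableOn ℂ g U := by
    refine (hSU.sub hGU).div (by fun_prop) fun w hw => pow_ne_zero _ (hne w hw)
  have hsub : {w : ℂ | 0 ≤ w.re} ⊆ U := fun w hw => by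
    have hw' : 0 ≤ w.re := hw
    show -(1 + h₀) / 2 < w.re
    linarith
  -- boundedness of `g` on the closed right half-plane
  set K₀ : ℝ := ‖Complex.Gamma (h₁ : ℂ) * Complex.Gamma (h₂ : ℂ) / Complex.Gamma ((h₀ : ℂ) - h₁ - h₂ + 1)‖ with hK₀
  have hbound : ∃ B : ℝ, ∀ w : ℂ, 0 ≤ w.re → ‖g w‖ ≤ B := by
    refine ⟨(M + K₀ * |C|) * (2 / min 1 (1 + h₀)) ^ N, fun w hw => ?_⟩
    have hwA : (‖w‖ + (1 + h₀)) / 2 ≤ ‖w + ((1 + h₀ : ℝ) : ℂ)‖ := norm_add_pos_ge hA0 hw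
    have hwA0 : 0 < ‖w + ((1 + h₀ : ℝ) : ℂ)‖ := lt_of_lt_of_le (by positivity) hwA
    have h1w : 1 ≤ 1 + ‖w‖ := by linarith [norm_nonneg w]
    have hM0 : 0 ≤ M := by rw [hM]; exact tsum_nonneg fun μ => norm_nonneg _
    rw [hg]
    simp only []
    rw [norm_div, norm_pow, div_le_iff₀ (by positivity)]
    have hnum : ‖S w - G w‖ ≤ M + K₀ * |C| * (1 + ‖w‖) ^ N := by
      calc ‖S w - G w‖ ≤ ‖S w‖ + ‖G w‖ := norm_sub_le _ _
        _ ≤ M + K₀ * (C * (1 + ‖w‖) ^ N) := add_le_add (hS_le w hw) (hG_le w hw)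
        _ ≤ M + K₀ * |C| * (1 + ‖w‖) ^ N := by
            have : C * (1 + ‖w‖) ^ N ≤ |C| * (1 + ‖w‖) ^ N :=
              mul_le_mul_of_nonneg_right (le_abs_self C) (by positivity)
            nlinarith [norm_nonneg (Complex.Gamma (h₁ : ℂ) * Complex.Gamma (h₂ : ℂ) /
              Complex.Gamma ((h₀ : ℂ) - h₁ - h₂ + 1)), mul_le_mul_of_nonneg_left this (norm_nonneg
              (Complex.Gamma (h₁ : ℂ) * Complex.Gamma (h₂ : ℂ) / Complex.Gamma ((h₀ : ℂ) - h₁ - h₂ + 1)))]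
    -- `(1 + ‖w‖) ≤ (2/m)‖w + A‖` with `m = min 1 A`
    set m : ℝ := min 1 (1 + h₀) with hm
    have hm0 : 0 < m := lt_min one_pos hA0
    have hm1 : m ≤ 1 := min_le_left _ _
    have hmA : m ≤ 1 + h₀ := min_le_right _ _
    have hκ : m * (1 + ‖w‖) ≤ 2 * ‖w + ((1 + h₀ : ℝ) : ℂ)‖ := by
      nlinarith [mul_nonneg (sub_nonneg.2 hm1) (norm_nonneg w)]
    have hle1 : 1 + ‖w‖ ≤ 2 / m * ‖w + ((1 + h₀ : ℝ) : ℂ)‖ := by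
      rw [div_mul_eq_mul_div, le_div_iff₀ hm0]; linarith
    have hpowle : (1 + ‖w‖) ^ N ≤ (2 / m) ^ N * ‖w + ((1 + h₀ : ℝ) : ℂ)‖ ^ N := by
      rw [← mul_pow]; exact pow_le_pow_left₀ (by positivity) hle1 N
    have hK0 : 0 ≤ K₀ * |C| := by positivity
    have h1N : (1 : ℝ) ≤ (1 + ‖w‖) ^ N := one_le_pow₀ h1w
    calc ‖S w - G w‖ ≤ M + K₀ * |C| * (1 + ‖w‖) ^ N := hnum
      _ ≤ (M + K₀ * |C|) * (1 + ‖w‖) ^ N := by nlinarith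
      _ ≤ (M + K₀ * |C|) * ((2 / m) ^ N * ‖w + ((1 + h₀ : ℝ) : ℂ)‖ ^ N) :=
          mul_le_mul_of_nonneg_left hpowle (by positivity)
      _ = (M + K₀ * |C|) * (2 / m) ^ N * ‖w + ((1 + h₀ : ℝ) : ℂ)‖ ^ N := by ring
  -- Carlson's theorem: `g = 0` on the closed right half-plane
  have hCarlson := Literature.Analysis.Complex.AndrewsAskeyRoy1999_thm_2_8_1_holds g ⟨U, hUo, hsub, hgU⟩ hbound
    (fun n => by
      have h := hnat n
      simp only [hg, h, sub_self, zero_div])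
  have hSG : ∀ w : ℂ, 0 ≤ w.re → S w = G w := by
    intro w hw
    have h0 := hCarlson w hw
    rw [hg] at h0
    simp only [div_eq_zero_iff, pow_eq_zero_iff', ne_eq] at h0
    rcases h0 with h0 | ⟨h0, -⟩
    · exact sub_eq_zero.1 h0
    · exact absurd h0 (hne w (hsub hw))
  -- the identity theorem on the convex half-plane `U`
  have hpre : IsPreconnected U := (convex_halfSpace_re_gt (-(1 + h₀) / 2)).isPreconnected
  have h1U : (1 : ℂ) ∈ U := by simp [hU]; linarith
  have hev : S =ᶠ[𝓝 (1 : ℂ)] G := by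
    have hopen : IsOpen {w : ℂ | 0 < w.re} := isOpen_lt continuous_const Complex.continuous_re
    exact Filter.eventually_of_mem (hopen.mem_nhds (by simp)) fun w hw => hSG w (le_of_lt hw)
  exact (hSU.analyticOnNhd hUo).eqOn_of_preconnected_of_eventuallyEq (hGU.analyticOnNhd hUo) hpre h1U hev hz

end Summit.KontsevichZagierPeriods.Zeta5Search.DougallNonterminating

end
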